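import Summits.NavierStokesRegularity.FluidComputer.ClayBlowupAxisZoomBounds
import Summits.NavierStokesRegularity.FluidComputer.ClayBlowupLocalZoomResidualLambda
import Literature.Analysis.FluidPDE.AncientMildCompactnessForcedAsymptDivFree
import Literature.Analysis.FluidPDE.KNSSTypeIRateVertexPerturbed
import HarnessLib

/-!
# THE AXIS ZOOM WITH FORCE UNDER A LOCAL TYPE-I BOUND (KNSS 2009 Thm 6.2's blow-up sequence for an
# axisymmetric Clay blow-up, WITH its Clay force)

Cell `ns-blowup`, seat `ns-blowup-ecbridge-2` (g12; the E–C endpoint theory seat). LABEL: E–C typing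
(KERNEL — no named fact, no new definition). WHAT THIS IS NOT: not Navier–Stokes evidence — a
necessary structure of the TYPE `ClayBlowup 1` under hypotheses later shown contradictory; no
inhabitant is claimed. Companion memo: `run/shared/lean/pub/ns-blowup/ecbridge2/ECBRIDGE-2-MEMO-11.md`.

`ClayBlowup.exists_axis_zoom_limit` (`ν = 1`): let `X` have axisymmetric slices, `x₁` an axis point,
the LOCAL Type-I bound `‖u(t,x)‖ ≤ C/√(T − t)` on `(t₀, T) × B(x₁, r₀)`, and `|x'|‖u‖` UNBOUNDED on
`[t_b, T) × B(x₁, r₀/4)`, `t_b = (t₀ + T)/2`. At the axis zoom data (`ClayBlowupAxisZoomData`; centres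
`y_k` on the meridian half-plane, `m_k = ‖u(τ_k, y_k)‖`, `M_k = m_k (y_k)₀ → ∞`) the zooms
`m_k⁻¹ u(τ_k + m_k⁻²·, y_k + m_k⁻¹·)`, truncated by Lipschitz cutoffs of `B(0, d_k m_k/2)`, obey the
Type-I profile `C/√(−τ)` (`ClayBlowupAxisZoomBounds`) and the perturbed Oseen identity with
perturbations `≤ Λ(t)²(P + 39Q)√lag` on windows with top `t < 0`, `Λ(t) = max 4 (C/√(−t))`
(`exists_local_zoom_residual_bounds_lambda` (i)), vanishing pointwise ((ii)); the engine
`exists_oseenMild_limit_of_forced_asymptDivFree` gives a limit `W` — continuous, weakly divergence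
free, UNFORCED Oseen-mild, `√(−s)‖W(s)‖ ≤ C`, `‖W‖ ≤ 8` ((wkbound) off the receding cylinder) —
attained locally uniformly on slices by the UNTRUNCATED zooms, and `‖W(s, 0)‖ ≥ 1/2` near `s = 0` by
the perturbed KNSS vertex estimate `knss_vertex_modulus_perturbed` ((wkbound2), `I(M) → 0`, (ii) at
base `−1`). References: Koch–Nadirashvili–Seregin–Šverák, Acta Math. 203 (2009), §6
[cite: KochNadirashviliSereginSverak2009, proof of Thm 6.2 (arXiv pp. 12–13), Lemma 6.1 (p. 11)].
-/
noncomputable section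

namespace Summit.NavierStokesRegularity.FluidComputer

open Set MeasureTheory Filter Topology Function Metric Real
open scoped ENNReal NNReal RealInnerProductSpace
open Literature.Analysis Literature.Analysis.FluidPDE
open Summit.NavierStokesRegularity.NavierStokesRegularity

namespace ClayBlowup

set_option maxHeartbeats 800000 in
-- one long bookkeeping proof: the engine's hypotheses, the limit's bounds, and the vertex estimate
/-- **THE AXIS ZOOM WITH FORCE UNDER A LOCAL TYPE-I BOUND** (`ν = 1`; no named fact): see the module
docstring. [cite: KochNadirashviliSereginSverak2009, proof of Thm 6.2 (arXiv pp. 12–13)] -/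
theorem exists_axis_zoom_limit (X : ClayBlowup 1) (hax : ∀ t ∈ Ico 0 X.T, IsAxisymmetric (X.u t))
    {x₁ : EuclideanSpace ℝ (Fin 3)} (hx₁ : cylRadius x₁ = 0) {r₀ t₀ C : ℝ} (hr₀ : 0 < r₀)
    (hr₀2 : r₀ ≤ 2) (ht₀ : t₀ ∈ Ico 0 X.T) (hC : 0 < C)
    (hI : ∀ t ∈ Ioo t₀ X.T, ∀ x ∈ ball x₁ r₀, ‖X.u t x‖ ≤ C / Real.sqrt (X.T - t))
    (hunb : ∀ L : ℝ, ∃ s ∈ Ico ((t₀ + X.T) / 2) X.T, ∃ z ∈ ball x₁ (r₀ / 4),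
      L < cylRadius z * ‖X.u s z‖) :
    ∃ (τ : ℕ → ℝ) (y : ℕ → EuclideanSpace ℝ (Fin 3)) (φ : ℕ → ℕ)
      (W : ℝ → EuclideanSpace ℝ (Fin 3) → EuclideanSpace ℝ (Fin 3)),
      StrictMono φ ∧ (∀ k, τ k ∈ Ico ((t₀ + X.T) / 2) X.T) ∧ (∀ k, y k 1 = 0 ∧ 0 ≤ y k 0) ∧
      (∀ k : ℕ, (k : ℝ) + 1 ≤ ‖X.u (τ k) (y k)‖) ∧
      Tendsto (fun j => ‖X.u (τ (φ j)) (y (φ j))‖ * y (φ j) 0) atTop atTop ∧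
      ContinuousOn (uncurry W) (Iio 0 ×ˢ univ) ∧ (∀ s < 0, IsWeaklyDivFree (W s)) ∧
      (∀ s t : ℝ, s < t → t < 0 → ∀ z,
        W t z = UnboundedOperators.heatExtension (W s) (t - s) z - oseenDuhamel 1 s W W t z) ∧
      (∀ s < 0, ∀ z, ‖W s z‖ ≤ 8) ∧ (∀ s < 0, ∀ z, Real.sqrt (-s) * ‖W s z‖ ≤ C) ∧
      (∃ σ₁ : ℝ, 0 < σ₁ ∧ ∀ s ∈ Ioo (-σ₁) 0, (1 / 2 : ℝ) ≤ ‖W s 0‖) ∧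
      (∀ s < 0, TendstoLocallyUniformly (fun j => (‖X.u (τ (φ j)) (y (φ j))‖⁻¹ •
          stPull (‖X.u (τ (φ j)) (y (φ j))‖⁻¹ ^ 2) ‖X.u (τ (φ j)) (y (φ j))‖⁻¹ (τ (φ j)) (y (φ j))
            X.u) s) (W s) atTop) := by
  have hT := X.T_pos
  -- ### the base time, the radius, the axis zoom data
  set t_b : ℝ := (t₀ + X.T) / 2 with ht_b_def
  have ht_b : t_b ∈ Ico 0 X.T := ⟨by rw [ht_b_def]; linarith [ht₀.1], by rw [ht_b_def]; linarith [ht₀.2]⟩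
  have ht_b0 : t₀ < t_b := by rw [ht_b_def]; linarith [ht₀.2]
  set r' : ℝ := r₀ / 2 with hr'_def
  have hr' : 0 < r' := by positivity
  have hr'1 : r' ≤ 1 := by rw [hr'_def]; linarith
  have hunb' : ∀ L : ℝ, ∃ s ∈ Ico t_b X.T, ∃ z ∈ ball x₁ (r' / 2), L < cylRadius z * ‖X.u s z‖ := by
    intro L; obtain ⟨s, hs, z, hz, h⟩ := hunb L
    exact ⟨s, hs, z, by rw [hr'_def, show r₀ / 2 / 2 = r₀ / 4 by ring]; exact hz, h⟩
  obtain ⟨τ, y, hdata⟩ := X.exists_axis_zoom_data hax hx₁ hr' ht_b hunb'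
  have hτ : ∀ k, τ k ∈ Ico t_b X.T := fun k => (hdata k).1
  have hy : ∀ k, y k ∈ ball x₁ r' := fun k => (hdata k).2.1
  have hhalf : ∀ k, y k 1 = 0 ∧ 0 ≤ y k 0 := fun k => (hdata k).2.2.1
  have hry : ∀ k, cylRadius (y k) = y k 0 := fun k => (hdata k).2.2.2.1
  have hr0 : ∀ k, 0 < cylRadius (y k) := fun k => (hdata k).2.2.2.2.1
  have hrd : ∀ k, cylRadius (y k) ≤ dist (y k) x₁ := fun k => (hdata k).2.2.2.2.2.1
  have hm0 : ∀ k, 0 < ‖X.u (τ k) (y k)‖ := fun k => (hdata k).2.2.2.2.2.2.1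
  have hL : ∀ k : ℕ, (k : ℝ) + 1 ≤ (r' - dist (y k) x₁) ^ 2 * (cylRadius (y k) * ‖X.u (τ k) (y k)‖) :=
    fun k => (hdata k).2.2.2.2.2.2.2.1
  have hB4 : ∀ k, ∀ s ∈ Icc t_b (τ k), ∀ z ∈ ball (y k) ((r' - dist (y k) x₁) / 2),
      cylRadius z * ‖X.u s z‖ ≤ 4 * (cylRadius (y k) * ‖X.u (τ k) (y k)‖) :=
    fun k => (hdata k).2.2.2.2.2.2.2.2.2
  set m : ℕ → ℝ := fun k => ‖X.u (τ k) (y k)‖ with hm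
  set d : ℕ → ℝ := fun k => r' - dist (y k) x₁ with hd
  set Mx : ℕ → ℝ := fun k => m k * y k 0 with hMx
  have hd0 : ∀ k, 0 < d k := fun k => sub_pos.2 (mem_ball.1 (hy k))
  have hd1 : ∀ k, d k ≤ 1 := fun k =>
    (show d k ≤ r' by simp only [hd]; linarith [dist_nonneg (x := y k) (y := x₁)]).trans hr'1
  have hr1 : ∀ k, cylRadius (y k) ≤ 1 := fun k => ((hrd k).trans (mem_ball.1 (hy k)).le).trans hr'1
  have hMxr : ∀ k, Mx k = cylRadius (y k) * m k := fun k => by simp only [hMx, hry k]; ring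
  have hMx0 : ∀ k, 0 < Mx k := fun k => by rw [hMxr]; exact mul_pos (hr0 k) (hm0 k)
  have hMxdef : ∀ k, Mx k = m k * y k 0 := fun k => rfl
  have hk1M : ∀ k : ℕ, (k : ℝ) + 1 ≤ Mx k := by
    intro k; rw [hMxr]
    have h1 : d k ^ 2 ≤ 1 := pow_le_one₀ (hd0 k).le (hd1 k)
    have h2 : 0 ≤ cylRadius (y k) * m k := mul_nonneg (cylRadius_nonneg _) (hm0 k).le
    calc (k : ℝ) + 1 ≤ d k ^ 2 * (cylRadius (y k) * m k) := hL k
      _ ≤ 1 * (cylRadius (y k) * m k) := mul_le_mul_of_nonneg_right h1 h2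
      _ = _ := one_mul _
  have hMm : ∀ k, Mx k ≤ m k := fun k => by
    rw [hMxr]; exact mul_le_of_le_one_left (hm0 k).le (hr1 k)
  have hk1 : ∀ k : ℕ, (k : ℝ) + 1 ≤ m k := fun k => (hk1M k).trans (hMm k)
  have hM1 : ∀ k, 1 ≤ m k := fun k => le_trans (by linarith [k.cast_nonneg (α := ℝ)]) (hk1 k)
  have hLm : ∀ k : ℕ, (k : ℝ) + 1 ≤ d k ^ 2 * m k := fun k =>
    (hL k).trans (by rw [← hMxr]; exact mul_le_mul_of_nonneg_left (hMm k) (sq_nonneg _))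
  have hdM : ∀ k : ℕ, (k : ℝ) + 1 ≤ d k * m k := fun k =>
    (hLm k).trans (mul_le_mul_of_nonneg_right (by nlinarith [hd0 k, hd1 k]) (hm0 k).le)
  set R : ℕ → ℝ := fun k => d k * m k / 2 with hR
  have hR0 : ∀ k, 0 < R k := fun k => by simp only [hR]; exact div_pos (mul_pos (hd0 k) (hm0 k)) two_pos
  have hRk : ∀ k : ℕ, ((k : ℝ) + 1) / 2 ≤ R k := fun k => by simp only [hR]; linarith [hdM k]
  have hRM : ∀ k, R k / m k = d k / 2 := fun k => by
    simp only [hR]; rw [div_right_comm, mul_div_cancel_right₀ _ (hm0 k).ne']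
  -- the `Θ`-collection is `≤ 39/(k+1)`
  have hΘ' : ∀ k : ℕ, 1 / R k + 1 / R k ^ 2 + (1 + m k) / R k ^ 4 + (m k)⁻¹ ≤ 39 / ((k : ℝ) + 1) :=
    fun k => theta_le_of_axis_data (hd0 k) (hM1 k) (hk1 k) (hdM k) (hLm k)
  have hΘ'39 : ∀ k : ℕ, 1 / R k + 1 / R k ^ 2 + (1 + m k) / R k ^ 4 + (m k)⁻¹ ≤ 39 := fun k =>
    (hΘ' k).trans (div_le_self (by norm_num) (by linarith [k.cast_nonneg (α := ℝ)]))
  have hΘ'0 : ∀ k : ℕ, 0 ≤ 1 / R k + 1 / R k ^ 2 + (1 + m k) / R k ^ 4 + (m k)⁻¹ := fun k => by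
    have := hR0 k; have := hm0 k; positivity
  have hΘ'lim : Tendsto (fun k : ℕ => 1 / R k + 1 / R k ^ 2 + (1 + m k) / R k ^ 4 + (m k)⁻¹) atTop (𝓝 0) := by
    refine squeeze_zero (fun k => hΘ'0 k) hΘ' ?_
    have h := (tendsto_one_div_add_atTop_nhds_zero_nat (𝕜 := ℝ)).const_mul 39
    rw [mul_zero] at h; exact h.congr fun k => by ring
  -- ### the zoomed windows `(A_k, 0]` and their physical times
  set A : ℕ → ℝ := fun k => -(τ k - t_b) * m k ^ 2 with hA
  have hAlim : Tendsto A atTop atBot := X.tendsto_axis_zoom_window one_pos ht_b hτ (fun k => le_rfl) hk1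
  have hphys : ∀ k σ, A k < σ → σ ≤ 0 → τ k + (m k)⁻¹ ^ 2 * σ ∈ Icc t_b (τ k) := by
    intro k σ hσ hσ0
    have hc0 : 0 < (m k)⁻¹ := inv_pos.2 (hm0 k)
    have hc2 : (m k)⁻¹ ^ 2 * m k ^ 2 = 1 := by rw [← mul_pow, inv_mul_cancel₀ (hm0 k).ne', one_pow]
    constructor
    · have h1 : (m k)⁻¹ ^ 2 * (-(τ k - t_b) * m k ^ 2) < (m k)⁻¹ ^ 2 * σ :=
        mul_lt_mul_of_pos_left (by simpa only [hA] using hσ) (pow_pos hc0 2)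
      have h2 : (m k)⁻¹ ^ 2 * (-(τ k - t_b) * m k ^ 2) = -(τ k - t_b) := by
        rw [show (m k)⁻¹ ^ 2 * (-(τ k - t_b) * m k ^ 2) = -(τ k - t_b) * ((m k)⁻¹ ^ 2 * m k ^ 2) by
          ring, hc2, mul_one]
      linarith
    · nlinarith [pow_pos hc0 2]
  have hdom : ∀ k σ, A k < σ → t₀ < τ k + (m k)⁻¹ ^ 2 * σ := by
    intro k σ hσ; by_cases hσ0 : σ ≤ 0
    · exact ht_b0.trans_le (hphys k σ hσ hσ0).1
    · push Not at hσ0; linarith [(hτ k).1, mul_pos (pow_pos (inv_pos.2 (hm0 k)) 2) hσ0]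
  have htbτ : ∀ k σ, A k < σ → σ < 0 → t_b < τ k := by
    intro k σ hσ hσ0; by_contra h
    have h0 : τ k = t_b := le_antisymm (not_lt.1 h) (hτ k).1
    have : A k = 0 := by simp only [hA, h0, sub_self, neg_zero, zero_mul]
    linarith
  -- the good ball lies in the Type-I ball
  have hball : ∀ k z, z ∈ ball (y k) (d k / 2) → z ∈ ball x₁ r₀ := by
    intro k z hz; rw [mem_ball] at hz ⊢
    have h2 : dist (y k) x₁ = r' - d k := by simp only [hd]; ring
    linarith [hd0 k, dist_triangle z (y k) x₁, show r' < r₀ by rw [hr'_def]; linarith]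
  have hballR : ∀ k z, z ∈ ball (y k) (R k / m k) → z ∈ ball x₁ r₀ := fun k z hz => hball k z (by rwa [hRM k] at hz)
  -- ### the ratio `Λ(t) = max 4 (C/√(−t))` and the window / base bounds
  set Λ : ℝ → ℝ := fun t => max 4 (C / Real.sqrt (-t)) with hΛ
  have hΛ4 : ∀ t, 4 ≤ Λ t := fun t => le_max_left _ _
  have hΛC : ∀ t, C / Real.sqrt (-t) ≤ Λ t := fun t => le_max_right _ _
  have hΛ0 : ∀ t, 0 ≤ Λ t := fun t => le_trans (by norm_num) (hΛ4 t)
  have hwin : ∀ k s t, A k < s → s ≤ t → t < 0 →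
      ∀ σ ∈ Icc (τ k + (m k)⁻¹ ^ 2 * s) (τ k + (m k)⁻¹ ^ 2 * t), ∀ z ∈ ball (y k) (R k / m k),
        ‖X.u σ z‖ ≤ Λ t * m k := by
    intro k s t hAs hst ht σ hσ z hz
    have h := X.window_norm_le_typeI hC.le hI (hτ k).2 (hm0 k) ht (hdom k s hAs) σ hσ z (hballR k z hz)
    exact h.trans (mul_le_mul_of_nonneg_right (hΛC t) (hm0 k).le)
  have hbase : ∀ k s t, A k < s → s ≤ t → t < 0 →
      ∀ z ∈ ball (y k) (R k / m k), ‖X.u (τ k + (m k)⁻¹ ^ 2 * s) z‖ ≤ Λ t * m k := by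
    intro k s t hAs hst ht z hz
    have hs : s < 0 := lt_of_le_of_lt hst ht
    have h := X.window_norm_le_typeI hC.le hI (hτ k).2 (hm0 k) hs (hdom k s hAs)
      (τ k + (m k)⁻¹ ^ 2 * s) ⟨le_rfl, le_rfl⟩ z (hballR k z hz)
    refine h.trans (mul_le_mul_of_nonneg_right ((monotoneOn_typeI_profile hC.le
      (mem_Iio.2 hs) (mem_Iio.2 ht) hst).trans (hΛC t)) (hm0 k).le)
  -- ### cutoffs, zooms, truncations, perturbations
  have hcut := fun k => exists_lipschitz_cutoff (E := EuclideanSpace ℝ (Fin 3)) (hR0 k)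
  choose χ hχ01 hχ1 hχ0 hχL hχc using hcut
  set w : ℕ → ℝ → EuclideanSpace ℝ (Fin 3) → EuclideanSpace ℝ (Fin 3) := fun k =>
    (m k)⁻¹ • stPull ((m k)⁻¹ ^ 2) (m k)⁻¹ (τ k) (y k) X.u with hw
  set wt : ℕ → ℝ → EuclideanSpace ℝ (Fin 3) → EuclideanSpace ℝ (Fin 3) := fun k σ z => χ k z • w k σ z with hwt
  set Gt : ℕ → ℝ → ℝ → EuclideanSpace ℝ (Fin 3) → EuclideanSpace ℝ (Fin 3) := fun k s t z =>
    wt k t z - UnboundedOperators.heatExtension (wt k s) (t - s) z + oseenDuhamel 1 s (wt k) (wt k) t z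
    with hGt
  have hw_apply : ∀ k σ z, w k σ z = (m k)⁻¹ • X.u (τ k + (m k)⁻¹ ^ 2 * σ) (y k + (m k)⁻¹ • z) := fun k σ z => rfl
  obtain ⟨P, Q, hP0, hQ0, hres⟩ := X.exists_local_zoom_residual_bounds_lambda
  have hresk : ∀ k, ∀ s t : ℝ, A k < s → s < t → t < 0 → (t - s ≤ 1 → ∀ z, ‖Gt k s t z‖ ≤
        Λ t ^ 2 * (P + Q * (1 / R k + 1 / R k ^ 2 + (1 + m k) / R k ^ 4 + (m k)⁻¹)) * Real.sqrt (t - s)) ∧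
      (∀ z, ‖z‖ ≤ R k / 4 → ‖Gt k s t z‖ ≤
        Λ t ^ 2 * (Q * (1 / R k + 1 / R k ^ 2 + (1 + m k) / R k ^ 4 + (m k)⁻¹)) * (Real.sqrt (t - s) + (t - s))) := by
    intro k s t hAs hst ht0
    have hAs' : -(τ k - t_b) * m k ^ 2 < s := by simpa only [hA] using hAs
    have h := hres (y₀ := y k) (hτ k).2 ht_b.1 (htbτ k s hAs (hst.trans ht0)) (hM1 k) (hR0 k) (hΛ4 t) (hχ01 k)
      (hχ1 k) (hχ0 k) (hχL k) (hχc k) s t hAs' hst ht0.le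
    exact ⟨fun hlag z => h.1 (hwin k s t hAs hst.le ht0) hlag z,
      fun z hz => h.2 (hbase k s t hAs hst.le ht0) z hz⟩
  -- the residual at the vertex from base `-1`, tops up to `0` (clause (ii), ratio `Λ(−1)`)
  have hresV : ∀ k, A k < -1 → ∀ t : ℝ, -1 < t → t ≤ 0 → ‖Gt k (-1) t 0‖ ≤
      Λ (-1) ^ 2 * (Q * (1 / R k + 1 / R k ^ 2 + (1 + m k) / R k ^ 4 + (m k)⁻¹)) * 2 := by
    intro k hk t ht1 ht0
    have hAs' : -(τ k - t_b) * m k ^ 2 < -1 := by simpa only [hA] using hk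
    have h := hres (y₀ := y k) (hτ k).2 ht_b.1 (htbτ k (-1) hk (by norm_num)) (hM1 k) (hR0 k) (hΛ4 (-1)) (hχ01 k)
      (hχ1 k) (hχ0 k) (hχL k) (hχc k) (-1) t hAs' ht1 ht0
    have hb := h.2 (hbase k (-1) (-1) hk le_rfl (by norm_num)) 0 (by rw [norm_zero]; linarith [hR0 k])
    refine hb.trans (mul_le_mul_of_nonneg_left ?_ (by have := hΛ0 (-1); have := hΘ'0 k; positivity))
    have hs1 : Real.sqrt (t - (-1)) ≤ 1 := Real.sqrt_le_one.mpr (by linarith)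
    linarith
  -- ### per-`k` facts: classical on `(A_k, 0]`, continuity, divergence
  have hcl : ∀ k, ∃ (g : ℝ → EuclideanSpace ℝ (Fin 3) → EuclideanSpace ℝ (Fin 3))
      (q : ℝ → EuclideanSpace ℝ (Fin 3) → ℝ), IsClassicalNSSolutionOn (Ioc (A k) 0) 1 g (w k) q := by
    intro k
    have h := X.classical.nsRescale_translate (inv_pos.2 (hm0 k)) (τ k) (y k)
    refine ⟨_, _, h.mono (fun σ hσ => ?_) (uniqueDiffOn_Ioc _ _)⟩
    have h1 := hphys k σ hσ.1 hσ.2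
    exact ⟨ht_b.1.trans h1.1, h1.2.trans_lt (hτ k).2⟩
  have hwslice : ∀ k, ∀ σ ∈ Ioc (A k) 0, Continuous (w k σ) := fun k σ hσ => by
    obtain ⟨g, q, h⟩ := hcl k; exact (h.contDiff_velocity hσ).continuous
  have hwdiv : ∀ k, ∀ σ ∈ Ioc (A k) 0, IsWeaklyDivFree (w k σ) := fun k σ hσ => by
    obtain ⟨g, q, h⟩ := hcl k
    exact VectorCalculus.IsDivFree.isWeaklyDivFree_holds (h.divFree σ hσ)
      (contDiff_infty.1 (h.contDiff_velocity hσ) 1)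
  have hwcont : ∀ k, ContinuousOn (uncurry (w k)) (Ioo (A k) 0 ×ˢ univ) := fun k => by
    obtain ⟨g, q, h⟩ := hcl k
    exact h.smooth_velocity.continuousOn.mono (Set.prod_mono Ioo_subset_Ioc_self subset_rfl)
  have hcont : ∀ k, ContinuousOn (uncurry (wt k)) (Ioo (A k) 0 ×ˢ univ) := by
    intro k
    have h0 : uncurry (wt k) = fun p : ℝ × EuclideanSpace ℝ (Fin 3) => χ k p.2 • uncurry (w k) p := by funext p; rfl
    rw [h0]; exact ((hχc k).comp continuous_snd).continuousOn.smul (hwcont k)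
  have hχsupp : ∀ k z, χ k z ≠ 0 → ‖z‖ < R k := by
    intro k z hz
    have : ¬ 3 * R k / 4 ≤ ‖z‖ := fun h' => hz (hχ0 k z h'); push Not at this; linarith [hR0 k]
  -- ### (wkbound3): the Type-I profile bounds the truncated zooms
  have hwI : ∀ k σ, A k < σ → σ < 0 → ∀ z, ‖z‖ < R k → ‖w k σ z‖ ≤ C / Real.sqrt (-σ) := by
    intro k σ hσ hσ0 z hz
    refine X.zoom_norm_le_typeI hC.le hI (hτ k).2 (hm0 k) hσ0 (hdom k σ hσ) (hball k _ ?_)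
    rw [mem_ball, dist_eq_norm, add_sub_cancel_left, norm_smul,
      Real.norm_of_nonneg (inv_pos.2 (hm0 k)).le, ← hRM k, div_eq_inv_mul]
    exact mul_lt_mul_of_pos_left hz (inv_pos.2 (hm0 k))
  have hwt_le_w : ∀ k σ z, ‖wt k σ z‖ ≤ ‖w k σ z‖ := by
    intro k σ z; show ‖χ k z • w k σ z‖ ≤ ‖w k σ z‖
    rw [norm_smul, Real.norm_of_nonneg (hχ01 k z).1]; exact mul_le_of_le_one_left (norm_nonneg _) (hχ01 k z).2
  have hbdd : ∀ k, ∀ σ ∈ Ioo (A k) 0, ∀ z, ‖wt k σ z‖ ≤ C / Real.sqrt (-σ) := by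
    intro k σ hσ z
    by_cases hz : χ k z = 0
    · show ‖χ k z • w k σ z‖ ≤ _
      rw [hz, zero_smul, norm_zero]; exact div_nonneg hC.le (Real.sqrt_nonneg _)
    · exact (hwt_le_w k σ z).trans (hwI k σ hσ.1 hσ.2 z (hχsupp k z hz))
  -- ### (wkbound2) and (wkbound) for the truncated zooms
  have hB4' : ∀ k, ∀ s ∈ Icc t_b (τ k), ∀ z ∈ ball (y k) (d k / 2),
      cylRadius z * ‖X.u s z‖ ≤ 4 * Mx k := fun k s hs z hz => by rw [hMxr]; exact hB4 k s hs z hz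
  have hwρ : ∀ k σ, A k < σ → σ ≤ 0 → ∀ z, ‖z‖ < R k →
      ‖w k σ z‖ * cylRadius (z - EuclideanSpace.single 0 (-Mx k)) ≤ 4 * Mx k := by
    intro k σ hσ hσ0 z hz
    have h := X.zoom_norm_mul_cylRadius_le (hhalf k).1 (hB4' k) (hm0 k) (hphys k σ hσ hσ0)
      (show ‖z‖ < d k * m k / 2 by simpa only [hR] using hz)
    simpa only [hMx] using h
  have hmul : ∀ k, ∀ σ ∈ Ioo (A k) 0, ∀ z,
      ‖wt k σ z‖ * (Mx k * Real.sqrt (-σ) + cylRadius (z - EuclideanSpace.single 0 (-Mx k))) ≤ (C + 4) * Mx k := by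
    intro k σ hσ z
    exact truncated_wkbound2 (w := w k σ) (hMx0 k).le hσ.2 hC.le (hχ01 k)
      (fun z' hz' => hχ0 k z' (by linarith [hR0 k])) (fun z' hz' => hwI k σ hσ.1 hσ.2 z' hz')
      (fun z' hz' => hwρ k σ hσ.1 hσ.2.le z' hz') z
  have hoff : ∀ k, ∀ σ ∈ Ioo (A k) 0, ∀ z,
      Mx k / 2 < cylRadius (z - EuclideanSpace.single 0 (-Mx k)) → ‖wt k σ z‖ ≤ 8 := by
    intro k σ hσ z hz
    exact truncated_wkbound_off_cylinder (w := w k σ) (hMx0 k) (hχ01 k)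
      (fun z' hz' => hχ0 k z' (by linarith [hR0 k])) (fun z' hz' => hwρ k σ hσ.1 hσ.2.le z' hz') hz
  -- ### the engine
  have hmild : ∀ k, ∀ s t : ℝ, A k < s → s < t → t < 0 → ∀ z,
      wt k t z = UnboundedOperators.heatExtension (wt k s) (t - s) z -
        oseenDuhamel 1 s (wt k) (wt k) t z + Gt k s t z := by
    intro k s t _ _ _ z; simp only [hGt]; abel
  have hγmono : MonotoneOn (fun t : ℝ => (max 4 (C / Real.sqrt (-t))) ^ 2 * (P + Q * 39)) (Iio 0) :=
    monotoneOn_ratio_sq hC.le (P + Q * 39) (by positivity)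
  have hGb : ∀ k, ∀ s t : ℝ, A k < s → s < t → t < 0 → t - s ≤ 1 → ∀ z,
      ‖Gt k s t z‖ ≤ (max 4 (C / Real.sqrt (-t))) ^ 2 * (P + Q * 39) * Real.sqrt (t - s) := by
    intro k s t hAs hst ht0 hlag z
    refine ((hresk k s t hAs hst ht0).1 hlag z).trans (mul_le_mul_of_nonneg_right ?_ (Real.sqrt_nonneg _))
    exact mul_le_mul_of_nonneg_left (add_le_add le_rfl (mul_le_mul_of_nonneg_left (hΘ'39 k) hQ0))
      (sq_nonneg _)
  have hRlim : Tendsto R atTop atTop := by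
    refine tendsto_atTop_mono hRk ?_
    exact (tendsto_atTop_add_const_right _ _ tendsto_natCast_atTop_atTop).atTop_div_const two_pos
  have hGlim : ∀ s t : ℝ, s < t → t < 0 → ∀ z, Tendsto (fun k => Gt k s t z) atTop (𝓝 0) := by
    intro s t hst ht0 z
    have hev : ∀ᶠ k in atTop, ‖Gt k s t z‖ ≤
        Λ t ^ 2 * (Q * (1 / R k + 1 / R k ^ 2 + (1 + m k) / R k ^ 4 + (m k)⁻¹)) * (Real.sqrt (t - s) + (t - s)) := by
      filter_upwards [hAlim.eventually (eventually_lt_atBot s),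
        hRlim.eventually (eventually_ge_atTop (4 * ‖z‖))] with k hk hkR using (hresk k s t hk hst ht0).2 z (by linarith)
    refine squeeze_zero_norm' hev ?_
    have h := ((hΘ'lim.const_mul Q).const_mul (Λ t ^ 2)).mul_const (Real.sqrt (t - s) + (t - s))
    rw [mul_zero, mul_zero, zero_mul] at h; exact h
  have hdivlim : ∀ t < 0, ∀ θ : EuclideanSpace ℝ (Fin 3) → ℝ,
      FunctionSpaces.IsTestFunctionOn (⊤ : TopologicalSpace.Opens (EuclideanSpace ℝ (Fin 3))) θ →
      Tendsto (fun k => ∫ x, ⟪wt k t x, gradient θ x⟫) atTop (𝓝 0) := by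
    intro t ht θ hθ
    obtain ⟨Rθ, hRθ⟩ := hθ.hasCompactSupport.isCompact.isBounded.subset_closedBall (0 : EuclideanSpace ℝ (Fin 3))
    have hev : ∀ᶠ k in atTop, ∫ x, ⟪wt k t x, gradient θ x⟫ = 0 := by
      filter_upwards [hAlim.eventually (eventually_lt_atBot t),
        hRlim.eventually (eventually_ge_atTop (2 * Rθ))] with k hk hkR
      have heq : (fun x => ⟪wt k t x, gradient θ x⟫) = fun x => ⟪w k t x, gradient θ x⟫ := by
        funext x
        by_cases hx : x ∈ tsupport θ
        · have hxR : ‖x‖ ≤ R k / 2 := by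
            have := hRθ hx; rw [mem_closedBall, dist_zero_right] at this; linarith
          show ⟪χ k x • w k t x, gradient θ x⟫ = ⟪w k t x, gradient θ x⟫
          rw [hχ1 k x hxR, one_smul]
        · have hg : gradient θ x = 0 := by
            have hx' : x ∉ tsupport (fderiv ℝ θ) := fun h => hx (tsupport_fderiv_subset ℝ h)
            have h0 : fderiv ℝ θ x = 0 := image_eq_zero_of_notMem_tsupport hx'
            rw [gradient, h0, map_zero]
          rw [hg, inner_zero_right, inner_zero_right]
      rw [heq]
      exact hwdiv k t ⟨hk, ht.le⟩ θ hθ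
    exact tendsto_const_nhds.congr' (hev.mono fun k hk => hk.symm)
  obtain ⟨φ, W, hφ, hWc, hWdiv, hWbd, hWmild, -, hWpt, hWloc⟩ :=
    exists_oseenMild_limit_of_forced_asymptDivFree hAlim (monotoneOn_typeI_profile hC.le) hγmono
      (fun t _ => by positivity) hcont hdivlim hmild hGb hGlim hbdd
  -- ### the limit: Type-I decay and the global bound `8`
  have hIW : ∀ s < 0, ∀ z, Real.sqrt (-s) * ‖W s z‖ ≤ C := by
    intro s hs z; have h := hWbd s hs z
    rw [le_div_iff₀ (Real.sqrt_pos.2 (by linarith))] at h; linarith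
  have hMxlim : Tendsto Mx atTop atTop := by
    refine tendsto_atTop_mono hk1M ?_
    exact tendsto_atTop_add_const_right _ _ tendsto_natCast_atTop_atTop
  have hW8 : ∀ s < 0, ∀ z, ‖W s z‖ ≤ 8 := by
    intro s hs z
    have hev : ∀ᶠ j in atTop, ‖wt (φ j) s z‖ ≤ 8 := by
      have hAφ : Tendsto (fun j => A (φ j)) atTop atBot := hAlim.comp hφ.tendsto_atTop
      have hMφ : Tendsto (fun j => Mx (φ j)) atTop atTop := hMxlim.comp hφ.tendsto_atTop
      have hRφ : Tendsto (fun j => R (φ j)) atTop atTop := hRlim.comp hφ.tendsto_atTop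
      filter_upwards [hAφ.eventually (eventually_lt_atBot s), hMφ.eventually (eventually_ge_atTop (4 * ‖z‖)),
        hRφ.eventually (eventually_gt_atTop ‖z‖)] with j hjA hjM hjR
      set k := φ j with hk
      refine (hwt_le_w k s z).trans ?_
      exact X.zoom_norm_le_eight (hhalf k).1 (hm0 k) (hMxdef k) (hMx0 k) (hB4' k) (hphys k s hjA hs.le)
        (show ‖z‖ < d k * m k / 2 by simpa only [hR] using hjR) (by linarith [hMx0 k, norm_nonneg z])
    exact le_of_tendsto ((hWpt s hs z).norm) hev
  -- ### the untruncated zooms converge locally uniformly on slices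
  have hconvU : ∀ s < 0, TendstoLocallyUniformly (fun j => w (φ j) s) (W s) atTop := by
    intro s hs
    refine tendstoLocallyUniformly_of_eventually_eq_nhds (hWloc s hs) fun x => ⟨ball x 1, ball_mem_nhds x one_pos, ?_⟩
    have hRφ : Tendsto (fun j => R (φ j)) atTop atTop := hRlim.comp hφ.tendsto_atTop
    filter_upwards [hRφ.eventually (eventually_ge_atTop (2 * (‖x‖ + 1)))] with j hj z hz
    show w (φ j) s z = χ (φ j) z • w (φ j) s z
    rw [hχ1 (φ j) z ?_, one_smul]
    have : ‖z‖ ≤ ‖z - x‖ + ‖x‖ := norm_le_norm_sub_add z x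
    have h2 : ‖z - x‖ < 1 := by rw [← dist_eq_norm]; exact mem_ball.1 hz
    linarith
  -- ### the vertex
  have hwt00 : ∀ k, ‖wt k 0 0‖ = 1 := by
    intro k
    show ‖χ k 0 • w k 0 0‖ = 1
    rw [hχ1 k 0 (by rw [norm_zero]; linarith [hR0 k]), one_smul, hw_apply, mul_zero, add_zero,
      smul_zero, add_zero, norm_smul, Real.norm_of_nonneg (inv_pos.2 (hm0 k)).le]
    exact inv_mul_cancel₀ (hm0 k).ne'
  have hLk : ∀ k, ∃ L : ℝ, ∀ σ ∈ Ioo (A k) 0, ∀ z, ‖wt k σ z‖ ≤ L := by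
    intro k
    obtain ⟨N, hN⟩ := X.exists_norm_le one_pos (hτ k).2
    refine ⟨(m k)⁻¹ * N, fun σ hσ z => (hwt_le_w k σ z).trans ?_⟩
    rw [hw_apply, norm_smul, Real.norm_of_nonneg (inv_pos.2 (hm0 k)).le]
    have h1 := hphys k σ hσ.1 hσ.2.le
    exact mul_le_mul_of_nonneg_left (hN _ ⟨ht_b.1.trans h1.1, h1.2⟩ _) (inv_pos.2 (hm0 k)).le
  set η : ℕ → ℝ := fun k => Λ (-1) ^ 2 * (Q * (1 / R k + 1 / R k ^ 2 + (1 + m k) / R k ^ 4 + (m k)⁻¹)) * 2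
    with hη
  have hηlim : Tendsto η atTop (𝓝 0) := by
    have h := ((hΘ'lim.const_mul Q).const_mul (Λ (-1) ^ 2)).mul_const 2
    rw [mul_zero, mul_zero, zero_mul] at h
    exact h
  have hvertex := knss_vertex_modulus_perturbed (w := wt) (G := Gt) (M := Mx) (A := A) (η := η) hC
    (show (0 : ℝ) < C + 4 + 8 by linarith) hMx0 hMxlim hAlim hηlim hcont hLk
    (fun k hk t ht1 ht0 => by simp only [hGt]; abel) (fun k hk t ht1 ht0 => hresV k hk t ht1 ht0)
    (fun k hk z => by
      have h := hbdd k (-1) ⟨hk, by norm_num⟩ z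
      rwa [neg_neg, Real.sqrt_one, div_one] at h)
    (fun k σ hσ z hz => (hoff k σ hσ z hz).trans (by linarith))
    (fun k σ hσ z => (hmul k σ hσ z).trans (by nlinarith [hMx0 k]))
  obtain ⟨δ, hδ, hevV⟩ := hvertex (1 / 2) (by norm_num)
  refine ⟨τ, y, φ, W, hφ, hτ, hhalf, hk1, ?_, hWc, hWdiv, hWmild, hW8, hIW, ⟨min δ 1, lt_min hδ one_pos,
    fun s hs => ?_⟩, hconvU⟩
  · exact hMxlim.comp hφ.tendsto_atTop
  · -- nontriviality passes to the limit at `(s, 0)`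
    have hs0 : s < 0 := hs.2
    have hsδ : s ∈ Icc (-δ) 0 := ⟨by linarith [hs.1, min_le_left δ 1], hs0.le⟩
    have hev : ∀ᶠ j in atTop, (1 / 2 : ℝ) ≤ ‖wt (φ j) s 0‖ := by
      filter_upwards [hφ.tendsto_atTop.eventually hevV] with j hj
      have h := hj s hsδ
      have h1 : ‖wt (φ j) 0 0‖ - ‖wt (φ j) s 0‖ ≤ ‖wt (φ j) 0 0 - wt (φ j) s 0‖ := norm_sub_norm_le _ _
      linarith [hwt00 (φ j)]
    exact ge_of_tendsto ((hWpt s hs0 0).norm) hev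

end ClayBlowup

end Summit.NavierStokesRegularity.FluidComputer

end
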